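import Mathlib
import Summits.CriticalPhenomena.CardyFormulaZ2.Theorems.CardyMagicRigidityNestingRigidityTransferReconstruction
import HarnessLib

/-!
# Stub S6 · `Transfer`: the one- and two-disc surround counts of regular configurations are rigid

Crux `Summit.CriticalPhenomena.CardyFormulaZ2.Theses.CardyMagicRigidity.NestingRigidity`
(stmt-CriticalPhenomena-4835), line `ring-cloud-tomography` (r3), registered stub
`stub_transfer : Transfer` (`NestingStatisticsAgree → LoopLimitZ2EqT`); continuation of
`…TransferReduction` (p112841) and `…TransferReconstruction` (ancestor / strict-ancestor count
formulas).  Configuration-level core of the RECONSTRUCTION step (ii) of `stub_transfer` /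
`stub_treeRigidity`, sorry-free: for two `Regular` configurations `c`, `c'`,

* §1 `ncard_loops_surrounding_eq_of_counts_eq`, `ncard_loops_interior_eq_of_counts_eq` — if the
  one-disc surround counts and the separated two-disc surround counts (`patternCount` at `S = univ`,
  rational centres and radii, separation `s + s' < ‖q − q'‖` as in `NestingStatisticsAgree`) agree in
  the window `B(0, R)`, then every open set has the same number of ancestors in the window on both
  sides, and for EVERY set `G` the number of loops of the window with winding interior exactly `G` is
  the same on both sides (the statistics see the multiset of interiors, and determine it);
* §2 `exists_interiorEquiv_of_counts_eq` — with agreement in every window, the loops of `c` and `c'`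
  correspond under a bijection preserving winding interiors (fibres of `u ↦ int u` have `≤ 2` elements
  by `Regular.separating`; `Equiv.ofFiberEquiv`); `patternCount_eq_of_counts_eq`,
  `patternCount_eq_of_patternCount_univ_eq` — hence ALL pattern counts agree (every number of discs,
  complex centres, real radii, window, index set; by `patternCount_eq_of_interiorEquiv`): for regular
  configurations the full-pattern counts of disjoint disc families with `n ≤ 2` discs determine every
  pattern count.

What this does NOT give (see the module docstring of `…TransferReduction`): the bijection preserves
interiors and traces, not the unbased loops — across configurations `Regular` does not make
`u ↦ int u` injective up to reversal — and the law-level version needs joint laws of counts ACROSS disc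
families, which `NestingStatisticsAgree` provides only family by family.
-/

noncomputable section

open MeasureTheory Set Filter Metric
open scoped Real Topology BigOperators

namespace Summit.CriticalPhenomena.CardyFormulaZ2.Cruxes.NestingRigidity.RingCloudTomography

open Literature.Probability.RandomPlanarGeometry Literature.Probability.Percolation
  Literature.Probability.LatticeModels
open Summit.CriticalPhenomena.CardyFormulaZ2.Theses.CardyMagicRigidity
open Summit.CriticalPhenomena.CardyFormulaZ2.Cruxes.NestingRigidity.PositiveConeWeightDoubling

/-! ## §1 The surround counts of a window determine the interiors of its loops -/

/-- **Equal one- and two-disc surround counts ⇒ equal ancestor counts.**  If two regular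
configurations have the same one-disc and the same separated two-disc surround counts at rational
data in the window `B(0, R)`, then every open set containing a rational closed disc of positive radius
has the same number of ancestors in the window on both sides (`ncard_loops_surrounding_eq_sInf`). -/
theorem ncard_loops_surrounding_eq_of_counts_eq {c c' : LoopConfig ℂ} (hc : Regular c)
    (hc' : Regular c') {R : ℝ}
    (h₁ : ∀ (q : ℚ × ℚ) (s : ℚ), 0 < s →
      patternCount c ![(⟨q.1, q.2⟩ : ℂ)] ![(s : ℝ)] R Finset.univ =
        patternCount c' ![(⟨q.1, q.2⟩ : ℂ)] ![(s : ℝ)] R Finset.univ)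
    (h₂ : ∀ (q q' : ℚ × ℚ) (s s' : ℚ), 0 < s → 0 < s' →
      (s : ℝ) + s' < ‖(⟨q.1, q.2⟩ : ℂ) - ⟨q'.1, q'.2⟩‖ →
      patternCount c ![(⟨q.1, q.2⟩ : ℂ), ⟨q'.1, q'.2⟩] ![(s : ℝ), s'] R Finset.univ =
        patternCount c' ![(⟨q.1, q.2⟩ : ℂ), ⟨q'.1, q'.2⟩] ![(s : ℝ), s'] R Finset.univ)
    {G : Set ℂ} (hG : IsOpen G) {q₀ : ℚ × ℚ} {s₀ : ℚ} (hs₀ : 0 < s₀)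
    (hD : closedBall (⟨q₀.1, q₀.2⟩ : ℂ) s₀ ⊆ G) :
    {u ∈ c.loops | u.range ⊆ ball (0 : ℂ) R ∧ G ⊆ {w | u.wind w ≠ 0}}.ncard =
      {u ∈ c'.loops | u.range ⊆ ball (0 : ℂ) R ∧ G ⊆ {w | u.wind w ≠ 0}}.ncard := by
  have hs₀' : (0 : ℝ) < s₀ := Rat.cast_pos.2 hs₀
  rw [ncard_loops_surrounding_eq_sInf hc hG hs₀' hD R, ncard_loops_surrounding_eq_sInf hc' hG hs₀' hD R,
    h₁ q₀ s₀ hs₀]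
  congr 2
  ext m
  constructor
  · rintro ⟨q, s, hs, hsub, hsep, rfl⟩
    exact ⟨q, s, hs, hsub, hsep, h₂ q₀ q s₀ s hs₀ hs hsep⟩
  · rintro ⟨q, s, hs, hsub, hsep, rfl⟩
    exact ⟨q, s, hs, hsub, hsep, (h₂ q₀ q s₀ s hs₀ hs hsep).symm⟩

/-- **The one- and two-disc surround counts of a window determine the multiset of interiors of its
loops.**  If two regular configurations have the same one-disc surround counts and the same separated
two-disc surround counts (`patternCount` at `S = univ`, rational centres and radii, separation
`s + s' < ‖q − q'‖` as in `NestingStatisticsAgree`) in the window `B(0, R)`, then for EVERY set `G`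
the number of loops of the window with winding interior exactly `G` is the same on both sides. -/
theorem ncard_loops_interior_eq_of_counts_eq {c c' : LoopConfig ℂ} (hc : Regular c)
    (hc' : Regular c') {R : ℝ}
    (h₁ : ∀ (q : ℚ × ℚ) (s : ℚ), 0 < s →
      patternCount c ![(⟨q.1, q.2⟩ : ℂ)] ![(s : ℝ)] R Finset.univ =
        patternCount c' ![(⟨q.1, q.2⟩ : ℂ)] ![(s : ℝ)] R Finset.univ)
    (h₂ : ∀ (q q' : ℚ × ℚ) (s s' : ℚ), 0 < s → 0 < s' →
      (s : ℝ) + s' < ‖(⟨q.1, q.2⟩ : ℂ) - ⟨q'.1, q'.2⟩‖ →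
      patternCount c ![(⟨q.1, q.2⟩ : ℂ), ⟨q'.1, q'.2⟩] ![(s : ℝ), s'] R Finset.univ =
        patternCount c' ![(⟨q.1, q.2⟩ : ℂ), ⟨q'.1, q'.2⟩] ![(s : ℝ), s'] R Finset.univ)
    (G : Set ℂ) :
    {u ∈ c.loops | u.range ⊆ ball (0 : ℂ) R ∧ {w | u.wind w ≠ 0} = G}.ncard =
      {u ∈ c'.loops | u.range ⊆ ball (0 : ℂ) R ∧ {w | u.wind w ≠ 0} = G}.ncard := by
  by_cases hG : IsOpen G ∧ G.Nonempty
  · obtain ⟨hGo, z, hz⟩ := hG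
    obtain ⟨q₀, s₀, hs₀, -, hD⟩ := exists_rat_closedBall_of_isOpen hGo hz
    have hs₀' : (0 : ℝ) < s₀ := Rat.cast_pos.2 hs₀
    -- ancestor counts agree on `G` and on every `G ∪ B(q, s)`
    have hanc := ncard_loops_surrounding_eq_of_counts_eq hc hc' h₁ h₂ hGo hs₀ hD
    have hstrict : {u ∈ c.loops | u.range ⊆ ball (0 : ℂ) R ∧ G ⊂ {w | u.wind w ≠ 0}}.ncard =
        {u ∈ c'.loops | u.range ⊆ ball (0 : ℂ) R ∧ G ⊂ {w | u.wind w ≠ 0}}.ncard := by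
      rw [ncard_loops_ssurrounding_eq_sSup hc hs₀' hD R, ncard_loops_ssurrounding_eq_sSup hc' hs₀' hD R]
      congr 1
      ext m
      have key : ∀ (q : ℚ × ℚ) (s : ℚ),
          {u ∈ c.loops | u.range ⊆ ball (0 : ℂ) R ∧
              G ∪ ball (⟨q.1, q.2⟩ : ℂ) s ⊆ {w | u.wind w ≠ 0}}.ncard =
            {u ∈ c'.loops | u.range ⊆ ball (0 : ℂ) R ∧
              G ∪ ball (⟨q.1, q.2⟩ : ℂ) s ⊆ {w | u.wind w ≠ 0}}.ncard := fun q s ↦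
        ncard_loops_surrounding_eq_of_counts_eq hc hc' h₁ h₂ (hGo.union isOpen_ball) hs₀
          (hD.trans Set.subset_union_left)
      constructor
      · rintro ⟨q, s, hs, hB, rfl⟩
        exact ⟨q, s, hs, hB, key q s⟩
      · rintro ⟨q, s, hs, hB, rfl⟩
        exact ⟨q, s, hs, hB, (key q s).symm⟩
    have hadd := ncard_loops_surrounding_eq_add hc G hs₀' hD R
    have hadd' := ncard_loops_surrounding_eq_add hc' G hs₀' hD R
    omega
  · -- no loop of a regular configuration has interior `G`
    have key : ∀ {d : LoopConfig ℂ}, Regular d →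
        {u ∈ d.loops | u.range ⊆ ball (0 : ℂ) R ∧ {w | u.wind w ≠ 0} = G} = ∅ := by
      intro d hd
      refine Set.eq_empty_of_forall_notMem fun u hu ↦ hG ?_
      rw [← hu.2.2]
      exact ⟨u.isOpen_setOf_wind_ne_zero, setOf_wind_ne_zero_nonempty_of_regular hd hu.1⟩
    rw [key hc, key hc']

/-! ## §2 Rigidity: the one- and two-disc surround counts determine all pattern counts -/

/-- **An interior-preserving bijection from the surround counts.**  If two regular configurations
have, in every window, the same one-disc surround counts and the same separated two-disc surround
counts at rational data, then their loops correspond under a bijection preserving winding interiors: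
the fibres of `u ↦ {W(u, ·) ≠ 0}` have at most two elements (`Regular.separating`), sit inside a
common window, and have equal cardinalities there (`ncard_loops_interior_eq_of_counts_eq`);
glue fibrewise bijections (`Equiv.ofFiberEquiv`). -/
theorem exists_interiorEquiv_of_counts_eq {c c' : LoopConfig ℂ} (hc : Regular c) (hc' : Regular c')
    (h₁ : ∀ (R : ℝ) (q : ℚ × ℚ) (s : ℚ), 0 < s →
      patternCount c ![(⟨q.1, q.2⟩ : ℂ)] ![(s : ℝ)] R Finset.univ =
        patternCount c' ![(⟨q.1, q.2⟩ : ℂ)] ![(s : ℝ)] R Finset.univ)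
    (h₂ : ∀ (R : ℝ) (q q' : ℚ × ℚ) (s s' : ℚ), 0 < s → 0 < s' →
      (s : ℝ) + s' < ‖(⟨q.1, q.2⟩ : ℂ) - ⟨q'.1, q'.2⟩‖ →
      patternCount c ![(⟨q.1, q.2⟩ : ℂ), ⟨q'.1, q'.2⟩] ![(s : ℝ), s'] R Finset.univ =
        patternCount c' ![(⟨q.1, q.2⟩ : ℂ), ⟨q'.1, q'.2⟩] ![(s : ℝ), s'] R Finset.univ) :
    ∃ e : c.loops ≃ c'.loops,
      ∀ u : c.loops, {w | (e u : UnbasedLoop ℂ).wind w ≠ 0} = {w | (u : UnbasedLoop ℂ).wind w ≠ 0} := by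
  classical
  -- the fibres of the interior map on both sides
  set A : Set ℂ → Set (UnbasedLoop ℂ) := fun G ↦ {u | u ∈ c.loops ∧ {w | u.wind w ≠ 0} = G}
    with hA
  set B : Set ℂ → Set (UnbasedLoop ℂ) := fun G ↦ {u | u ∈ c'.loops ∧ {w | u.wind w ≠ 0} = G}
    with hB
  -- fibres have at most two elements, hence are finite
  have hfin : ∀ {d : LoopConfig ℂ}, Regular d → ∀ G : Set ℂ,
      ({u | u ∈ d.loops ∧ {w | u.wind w ≠ 0} = G} : Set (UnbasedLoop ℂ)).Finite := by
    intro d hd G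
    rcases ({u | u ∈ d.loops ∧ {w | u.wind w ≠ 0} = G} : Set (UnbasedLoop ℂ)).eq_empty_or_nonempty
      with h | ⟨u, hu⟩
    · rw [h]
      exact Set.finite_empty
    · refine ((Set.finite_singleton u.reverse).insert u).subset fun v hv ↦ ?_
      rcases hd.separating v hv.1 u hu.1 (hv.2.trans hu.2.symm) with h | h
      · exact Or.inl h
      · exact Or.inr h
  have hfinA : ∀ G, (A G).Finite := hfin hc
  have hfinB : ∀ G, (B G).Finite := hfin hc'
  -- both fibres over `G` sit inside one window
  have hwin : ∀ G, ∃ R : ℝ, (∀ u ∈ A G, u.range ⊆ ball (0 : ℂ) R) ∧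
      ∀ u ∈ B G, u.range ⊆ ball (0 : ℂ) R := by
    intro G
    have hb : Bornology.IsBounded (⋃ u ∈ A G ∪ B G, u.range) :=
      (Bornology.isBounded_biUnion ((hfinA G).union (hfinB G))).2
        fun u _ ↦ u.isCompact_range.isBounded
    obtain ⟨R, hR⟩ := hb.subset_ball 0
    exact ⟨R, fun u hu ↦ (Set.subset_biUnion_of_mem (u := fun v : UnbasedLoop ℂ ↦ v.range)
        (Or.inl hu : u ∈ A G ∪ B G)).trans hR,
      fun u hu ↦ (Set.subset_biUnion_of_mem (u := fun v : UnbasedLoop ℂ ↦ v.range)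
        (Or.inr hu : u ∈ A G ∪ B G)).trans hR⟩
  -- so they have the same cardinality
  have hcard : ∀ G, (A G).ncard = (B G).ncard := by
    intro G
    obtain ⟨R, hRA, hRB⟩ := hwin G
    have eA : A G = {u ∈ c.loops | u.range ⊆ ball (0 : ℂ) R ∧ {w | u.wind w ≠ 0} = G} :=
      Set.ext fun u ↦ ⟨fun hu ↦ ⟨hu.1, hRA u hu, hu.2⟩, fun hu ↦ ⟨hu.1, hu.2.2⟩⟩
    have eB : B G = {u ∈ c'.loops | u.range ⊆ ball (0 : ℂ) R ∧ {w | u.wind w ≠ 0} = G} :=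
      Set.ext fun u ↦ ⟨fun hu ↦ ⟨hu.1, hRB u hu, hu.2⟩, fun hu ↦ ⟨hu.1, hu.2.2⟩⟩
    rw [eA, eB]
    exact ncard_loops_interior_eq_of_counts_eq hc hc' (h₁ R) (h₂ R) G
  -- fibrewise bijections, glued
  have hequiv : ∀ G, Nonempty (A G ≃ B G) := fun G ↦ by
    haveI := (hfinA G).to_subtype
    haveI := (hfinB G).to_subtype
    exact Finite.card_eq.1 (by rw [Nat.card_coe_set_eq, Nat.card_coe_set_eq, hcard G])
  have Φ : ∀ G : Set ℂ,
      {a : c.loops // (fun u : c.loops ↦ {w | (u : UnbasedLoop ℂ).wind w ≠ 0}) a = G} ≃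
        {b : c'.loops // (fun u : c'.loops ↦ {w | (u : UnbasedLoop ℂ).wind w ≠ 0}) b = G} :=
    fun G ↦
      (Equiv.subtypeSubtypeEquivSubtypeInter (fun u : UnbasedLoop ℂ ↦ u ∈ c.loops)
          (fun u ↦ {w | u.wind w ≠ 0} = G)).trans
        ((hequiv G).some.trans
          (Equiv.subtypeSubtypeEquivSubtypeInter (fun u : UnbasedLoop ℂ ↦ u ∈ c'.loops)
            (fun u ↦ {w | u.wind w ≠ 0} = G)).symm)
  exact ⟨Equiv.ofFiberEquiv Φ, fun u ↦
    Equiv.ofFiberEquiv_map (f := fun u : c.loops ↦ {w | (u : UnbasedLoop ℂ).wind w ≠ 0})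
      (g := fun u : c'.loops ↦ {w | (u : UnbasedLoop ℂ).wind w ≠ 0}) Φ u⟩

/-- **Rigidity of the pattern counts of regular configurations.**  If two regular configurations
have, in every window, the same one-disc surround counts and the same separated two-disc surround
counts at rational data (`patternCount` at `S = univ`, `n = 1, 2`), then ALL their pattern counts
coincide — every number of discs, all complex centres and real radii, every window and index set
(`exists_interiorEquiv_of_counts_eq` + `patternCount_eq_of_interiorEquiv`). -/
theorem patternCount_eq_of_counts_eq {c c' : LoopConfig ℂ} (hc : Regular c) (hc' : Regular c')
    (h₁ : ∀ (R : ℝ) (q : ℚ × ℚ) (s : ℚ), 0 < s →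
      patternCount c ![(⟨q.1, q.2⟩ : ℂ)] ![(s : ℝ)] R Finset.univ =
        patternCount c' ![(⟨q.1, q.2⟩ : ℂ)] ![(s : ℝ)] R Finset.univ)
    (h₂ : ∀ (R : ℝ) (q q' : ℚ × ℚ) (s s' : ℚ), 0 < s → 0 < s' →
      (s : ℝ) + s' < ‖(⟨q.1, q.2⟩ : ℂ) - ⟨q'.1, q'.2⟩‖ →
      patternCount c ![(⟨q.1, q.2⟩ : ℂ), ⟨q'.1, q'.2⟩] ![(s : ℝ), s'] R Finset.univ =
        patternCount c' ![(⟨q.1, q.2⟩ : ℂ), ⟨q'.1, q'.2⟩] ![(s : ℝ), s'] R Finset.univ)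
    {n : ℕ} (x : Fin n → ℂ) (r : Fin n → ℝ) (R : ℝ) (S : Finset (Fin n)) :
    patternCount c x r R S = patternCount c' x r R S := by
  obtain ⟨e, he⟩ := exists_interiorEquiv_of_counts_eq hc hc' h₁ h₂
  exact patternCount_eq_of_interiorEquiv hc.boundary hc'.boundary e he x r R S

/-- **The same in the quantifier shape of `NestingStatisticsAgree`**: for two regular configurations,
agreement of the full-pattern counts (`S = univ`) of the disjoint disc families with at most two discs
(positive radii, separation `r i + r j < ‖z i − z j‖`, every window) forces agreement of all pattern
counts.  Configuration-level core of step (ii) of `stub_transfer` / `stub_treeRigidity`: the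
nesting-tree statistics see exactly the multiset of winding interiors. -/
theorem patternCount_eq_of_patternCount_univ_eq : ∀ {c c' : LoopConfig ℂ}, Regular c →
    Regular c' →
    (∀ (n : ℕ) (z : Fin n → ℂ) (r : Fin n → ℝ) (R : ℝ), n ≤ 2 → (∀ i, 0 < r i) →
      (∀ i j, i ≠ j → r i + r j < ‖z i - z j‖) →
      patternCount c z r R Finset.univ = patternCount c' z r R Finset.univ) →
    ∀ {n : ℕ} (x : Fin n → ℂ) (r : Fin n → ℝ) (R : ℝ) (S : Finset (Fin n)),
      patternCount c x r R S = patternCount c' x r R S := by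
  intro c c' hc hc' h n x r R S
  refine patternCount_eq_of_counts_eq hc hc' (fun R q s hs ↦ ?_) (fun R q q' s s' hs hs' hsep ↦ ?_)
    x r R S
  · refine h 1 _ _ R (by norm_num) (fun i ↦ ?_) (fun i j hij ↦ ?_)
    · fin_cases i
      simpa using hs
    · exact absurd (Subsingleton.elim i j) hij
  · refine h 2 _ _ R le_rfl (fun i ↦ ?_) (fun i j hij ↦ ?_)
    · fin_cases i
      · simpa using hs
      · simpa using hs'
    · fin_cases i <;> fin_cases j
      · exact absurd rfl hij
      · simpa using hsep
      · simpa [add_comm, norm_sub_rev] using hsep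
      · exact absurd rfl hij

end Summit.CriticalPhenomena.CardyFormulaZ2.Cruxes.NestingRigidity.RingCloudTomography

end
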